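import Summits.ValiantsHypothesis.ValiantsHypothesis.Theorems.GrenetZeonTwoDimCoefficientsUnitCase
import Literature.Computability.AlgebraicComplexity.HessianRank
import HarnessLib

/-!
# Crux `GrenetZeon.TwoDimCoefficients` (stmt-ValiantsHypothesis-8062), line `dim2_cases`:
# the reduced unit case, part 1 — Hessian calculus and a good point of `Z(per_n)`

First of three files proving the REDUCED unit case (the provable half of the registered stub
`stub_unitDichotomy`; see the seat's census attached to the item): if `det A = c + per_n · q` for an
affine `m × m` matrix `A`, `q ≠ 0`, and `per_n` does not divide the top homogeneous component of `q`,
then `n² ≤ 2m + 2` (assembled in `…UnitReducedTop`).  This file: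

* `hessianMatrix_mul`, `hessianMatrix_C_add`, `hessianMatrix_C_mul`, `hessianMatrix_sum` — Hessian
  calculus at a point (product rule `H(fg) = f H(g) + g H(f) + ∇f∇gᵀ + ∇g∇fᵀ`).
* `exists_eval_perPoly_eq_zero_and_eval_ne_zero` — a polynomial not divisible by `per_n` does not
  vanish identically on `Z(per_n)` (the ideal `(per_n)` is prime: `perPoly_irreducible`;
  Nullstellensatz `MvPolynomial.IsPrime.vanishingIdeal_zeroLocus`).
* `exists_eval_pderiv_perPoly_ne_zero` — Euler's identity: where the Hessian of `per_n` is
  invertible the gradient is non-zero (`n ≥ 3`).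
* `exists_goodPoint` — STEP 1: a point `p₁ ∈ Z(per_n)` with `f(p₁) ≠ 0`, `Hess per_n(p₁)` invertible
  (the Hessian determinant is non-zero at the Mignon–Ressayre point, so `per_n ∤ f · det ∂²per_n`),
  and a coordinate `i` with `∂ᵢ per_n(p₁) ≠ 0`.

HONEST FRAMING: helper lemmas for an ASIDE item; `VP ≠ VNP` is not moved.

References: T. Mignon, N. Ressayre, Int. Math. Res. Not. 2004:79, Thm. 1.1; J. M. Landsberg,
*Geometry and Complexity Theory* (2017), §6.4.6 (the point `y₀`, Lemma 6.4.6.3).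
-/

set_option linter.dupNamespace false

noncomputable section

namespace Summit.ValiantsHypothesis.ValiantsHypothesis.Cruxes.TwoDimCoefficients.DimTwoCases

open MvPolynomial Matrix
open Literature.Computability.AlgebraicComplexity

/-! ### Hessian calculus at a point -/

section HessianCalc

variable {k : Type*} [CommRing k] {σ : Type*}

/-- Product rule for the Hessian at a point:
`H(fg)(x) = f(x) H(g)(x) + g(x) H(f)(x) + ∇f ∇gᵀ + ∇g ∇fᵀ`. -/
theorem hessianMatrix_mul (f g : MvPolynomial σ k) (x : σ → k) :
    hessianMatrix (f * g) x = eval x f • hessianMatrix g x + eval x g • hessianMatrix f x +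
      (vecMulVec (fun s => eval x (pderiv s f)) (fun s => eval x (pderiv s g)) +
        vecMulVec (fun s => eval x (pderiv s g)) (fun s => eval x (pderiv s f))) := by
  ext s t
  simp only [hessianMatrix_apply, Matrix.add_apply, Matrix.smul_apply, vecMulVec_apply,
    smul_eq_mul, pderiv_mul, map_add, map_mul]
  ring

/-- The Hessian of `C c + f` is that of `f`. -/
theorem hessianMatrix_C_add (c : k) (f : MvPolynomial σ k) (x : σ → k) :
    hessianMatrix (C c + f) x = hessianMatrix f x := by
  ext s t
  simp only [hessianMatrix_apply, map_add, pderiv_C, zero_add]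

/-- The Hessian of `C c * f` is `c` times that of `f`. -/
theorem hessianMatrix_C_mul (c : k) (f : MvPolynomial σ k) (x : σ → k) :
    hessianMatrix (C c * f) x = c • hessianMatrix f x := by
  rw [C_mul', hessianMatrix_smul]

/-- The Hessian is additive over finite sums. -/
theorem hessianMatrix_sum {ι : Type*} (s : Finset ι) (f : ι → MvPolynomial σ k) (x : σ → k) :
    hessianMatrix (∑ i ∈ s, f i) x = ∑ i ∈ s, hessianMatrix (f i) x := by
  classical
  induction s using Finset.induction_on with
  | empty => simp [hessianMatrix_zero]
  | insert a s ha ih => rw [Finset.sum_insert ha, Finset.sum_insert ha, hessianMatrix_add, ih]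

/-- `hessianMatrix` agrees with `hess0 ∘ transl`. -/
theorem hessianMatrix_eq_hess0_transl' (f : MvPolynomial σ k) (x : σ → k) :
    hessianMatrix f x = hess0 (transl x f) := by
  ext s t
  rw [hessianMatrix_apply, hess0_transl]

end HessianCalc

/-! ### Step 1: a good point of the permanental hypersurface -/

section GoodPoint

/-- The Hessian of `per_{k+3}` at the Mignon–Ressayre point is invertible. -/
theorem isUnit_det_hessianMatrix_perPoly_mrPoint (k : ℕ) :
    IsUnit (hessianMatrix (perPoly (Fin (k + 3)) ℂ) (mrPoint ℂ k)).det := by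
  rw [hessianMatrix_eq_hess0_transl', hess0_transl_mrPoint_perPoly, ← Matrix.isUnit_iff_isUnit_det]
  refine Matrix.mulVec_injective_iff_isUnit.mp fun v w hvw => mrHess_mulVec_injective ?_
  simp only [Matrix.smul_mulVec] at hvw
  exact smul_right_injective _ (by exact_mod_cast Nat.factorial_ne_zero k : (k.factorial : ℂ) ≠ 0) hvw

/-- **Non-vanishing on the permanental hypersurface.** A polynomial not divisible by `per_n` has a
non-zero value at some point of `Z(per_n)` (`n ≥ 1`; the ideal `(per_n)` is prime, Nullstellensatz). -/
theorem exists_eval_perPoly_eq_zero_and_eval_ne_zero {n : ℕ} (hn : 0 < n)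
    (f : MvPolynomial (Fin n × Fin n) ℂ) (hf : ¬ perPoly (Fin n) ℂ ∣ f) :
    ∃ x : Fin n × Fin n → ℂ, eval x (perPoly (Fin n) ℂ) = 0 ∧ eval x f ≠ 0 := by
  haveI : Nonempty (Fin n) := ⟨⟨0, hn⟩⟩
  haveI hprime :
      (Ideal.span {perPoly (Fin n) ℂ} : Ideal (MvPolynomial (Fin n × Fin n) ℂ)).IsPrime :=
    (Ideal.span_singleton_prime (perPoly_irreducible (n := Fin n) (R := ℂ)).ne_zero).mpr
      (UniqueFactorizationMonoid.irreducible_iff_prime.mp (perPoly_irreducible (n := Fin n) (R := ℂ)))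
  have hmem : f ∉ vanishingIdeal ℂ
      (zeroLocus ℂ (Ideal.span {perPoly (Fin n) ℂ} : Ideal (MvPolynomial (Fin n × Fin n) ℂ))) := by
    rw [MvPolynomial.IsPrime.vanishingIdeal_zeroLocus, Ideal.mem_span_singleton]
    exact hf
  rw [mem_vanishingIdeal_iff] at hmem
  push Not at hmem
  obtain ⟨x, hx, hfx⟩ := hmem
  rw [zeroLocus_span, Set.mem_setOf_eq] at hx
  have hx' := hx _ (Set.mem_singleton _)
  rw [aeval_eq_eval] at hx' hfx
  exact ⟨x, hx', hfx⟩

/-- **Euler**: at a zero-gradient point the Hessian of the permanent kills the point itself,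
so a point with invertible Hessian has a non-zero gradient (`n ≥ 3`). -/
theorem exists_eval_pderiv_perPoly_ne_zero {k : ℕ} (p : Fin (k + 3) × Fin (k + 3) → ℂ)
    (hH : IsUnit (hessianMatrix (perPoly (Fin (k + 3)) ℂ) p).det) :
    ∃ i, eval p (pderiv i (perPoly (Fin (k + 3)) ℂ)) ≠ 0 := by
  by_contra hall
  push Not at hall
  -- Euler: `Σ_s x_s ∂_s∂_t per = (n-1) ∂_t per`, evaluated at `p`: `p ᵛ* H = (n-1) ∇per(p) = 0`
  have hEuler : ∀ t, ∑ s, p s * hessianMatrix (perPoly (Fin (k + 3)) ℂ) p s t = 0 := by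
    intro t
    have hhom : (pderiv t (perPoly (Fin (k + 3)) ℂ)).IsHomogeneous (k + 2) := by
      have h := (perPoly_isHomogeneous (n := Fin (k + 3)) (k := ℂ)).pderiv (i := t)
      rwa [Fintype.card_fin] at h
    have h := congrArg (eval p) hhom.sum_X_mul_pderiv
    rw [map_sum, map_nsmul, hall t, smul_zero] at h
    rw [← h]
    refine Finset.sum_congr rfl fun s _ => ?_
    rw [map_mul, eval_X, hessianMatrix_apply]
  have hvec : Matrix.vecMul p (hessianMatrix (perPoly (Fin (k + 3)) ℂ) p) = 0 := by
    ext t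
    rw [Matrix.vecMul, dotProduct]
    exact hEuler t
  have hp0 : p = 0 := by
    have hinj := Matrix.vecMul_injective_iff_isUnit.mpr ((Matrix.isUnit_iff_isUnit_det _).mpr hH)
    exact hinj (hvec.trans (Matrix.zero_vecMul _).symm)
  -- but at `p = 0` the Hessian vanishes (its entries are forms of degree `k + 1 ≥ 1`)
  have hH0 : hessianMatrix (perPoly (Fin (k + 3)) ℂ) p = 0 := by
    ext s t
    rw [hessianMatrix_apply, Matrix.zero_apply, hp0,
      show (0 : Fin (k + 3) × Fin (k + 3) → ℂ) = (0 : ℂ) • (0 : Fin (k + 3) × Fin (k + 3) → ℂ) by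
        rw [zero_smul],
      eval_smul_pderiv_pderiv_perPoly, zero_pow (by omega : k + 3 - 2 ≠ 0), zero_mul]
  rw [hH0, Matrix.det_zero] at hH
  exact not_isUnit_zero hH

/-- **Step 1.** If `per_n ∤ f` (`n = k + 3`), there are a point `p₁ ∈ Z(per_n)` with `f(p₁) ≠ 0` and
invertible `Hess per_n(p₁)`, and a coordinate `i` with `∂ᵢ per_n(p₁) ≠ 0`. -/
theorem exists_goodPoint (k : ℕ) (f : MvPolynomial (Fin (k + 3) × Fin (k + 3)) ℂ)
    (hf : ¬ perPoly (Fin (k + 3)) ℂ ∣ f) :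
    ∃ (p : Fin (k + 3) × Fin (k + 3) → ℂ) (i : Fin (k + 3) × Fin (k + 3)),
      eval p (perPoly (Fin (k + 3)) ℂ) = 0 ∧ eval p f ≠ 0 ∧
      IsUnit (hessianMatrix (perPoly (Fin (k + 3)) ℂ) p).det ∧
      eval p (pderiv i (perPoly (Fin (k + 3)) ℂ)) ≠ 0 := by
  classical
  -- the Hessian determinant as a polynomial
  set HP : Matrix (Fin (k + 3) × Fin (k + 3)) (Fin (k + 3) × Fin (k + 3))
      (MvPolynomial (Fin (k + 3) × Fin (k + 3)) ℂ) :=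
    Matrix.of fun s t => pderiv s (pderiv t (perPoly (Fin (k + 3)) ℂ)) with hHP
  have hdet : ∀ y, eval y HP.det = (hessianMatrix (perPoly (Fin (k + 3)) ℂ) y).det := fun y => by
    rw [RingHom.map_det]
    rfl
  have hHPndvd : ¬ perPoly (Fin (k + 3)) ℂ ∣ HP.det := by
    rintro ⟨r, hr⟩
    have h := hdet (mrPoint ℂ k)
    rw [hr, map_mul, eval_mrPoint_perPoly, zero_mul] at h
    exact (isUnit_det_hessianMatrix_perPoly_mrPoint k).ne_zero h.symm
  have hprime : Prime (perPoly (Fin (k + 3)) ℂ) :=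
    UniqueFactorizationMonoid.irreducible_iff_prime.mp (perPoly_irreducible (n := Fin (k + 3)) (R := ℂ))
  have hndvd : ¬ perPoly (Fin (k + 3)) ℂ ∣ f * HP.det := fun h =>
    (hprime.dvd_or_dvd h).elim hf hHPndvd
  obtain ⟨p, hp, hpf⟩ := exists_eval_perPoly_eq_zero_and_eval_ne_zero (by omega) _ hndvd
  rw [map_mul] at hpf
  have hunit : IsUnit (hessianMatrix (perPoly (Fin (k + 3)) ℂ) p).det := by
    rw [← hdet, isUnit_iff_ne_zero]
    exact right_ne_zero_of_mul hpf
  obtain ⟨i, hi⟩ := exists_eval_pderiv_perPoly_ne_zero p hunit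
  exact ⟨p, i, hp, left_ne_zero_of_mul hpf, hunit, hi⟩

end GoodPoint

end Summit.ValiantsHypothesis.ValiantsHypothesis.Cruxes.TwoDimCoefficients.DimTwoCases
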